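import Mathlib

/-!
# Route BalabanIR — crux 3 `BirBdGPhaseCoercivity` (item `stmt-HubbardSuperconductivity-2081`):
# IX. The two-fluid determinant identity and the concavity tangent of `log det`

First lemmas of the crux idea `feshbach-shell-logdet` (Cruxes/BirBdGPhaseCoercivity/Ideas):
* `det_add_eq_twoFluid` — exact elimination of one covariance piece inside a determinant: if
  `T⁻¹ = C₁ + C₂` and `1 + C₂V` is invertible then
  `det(T + V) = det T · det(1 + C₂V) · det(1 + C₁V(1 + C₂V)⁻¹)` (Feshbach/Schur step, one-body);
* `log_det_le_tangent` — the tangent inequality of the concave function `log det` on positive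
  definite matrices: `log det M ≤ log det M₀ + Tr(M₀⁻¹(M - M₀))` (`log x ≤ x - 1` eigenvalue by
  eigenvalue for `M₀^{-1/2} M M₀^{-1/2}`).

References: the idea card `feshbach-shell-logdet` (ideator 2, 2026-08-16); V. Bach, J. Fröhlich,
I. M. Sigal, Adv. Math. 137 (1998) 299 (Feshbach map); R. Bhatia, *Matrix Analysis* (1997), §V
(concavity of `log det`). No definition is introduced.
-/

noncomputable section

open scoped ComplexOrder MatrixOrder

namespace Summit.HubbardSuperconductivity.HubbardSuperconductivity.Theorems

open Matrix

variable {n : Type*} [Fintype n] [DecidableEq n]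

/-! ### The two-fluid determinant identity -/

/-- **Two-fluid determinant identity** (Feshbach/Schur elimination of the covariance piece `C₂`):
if `T` is invertible with `T⁻¹ = C₁ + C₂` and `1 + C₂ V` is invertible, then
`det(T + V) = det T · det(1 + C₂ V) · det(1 + C₁ V (1 + C₂ V)⁻¹)`. [folklore] -/
theorem det_add_eq_twoFluid (T V C₁ C₂ : Matrix n n ℂ) (hT : IsUnit T) (hC : T⁻¹ = C₁ + C₂)
    (h₂ : IsUnit (1 + C₂ * V)) :
    (T + V).det = T.det * (1 + C₂ * V).det * (1 + C₁ * V * (1 + C₂ * V)⁻¹).det := by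
  have hTdet : IsUnit T.det := (Matrix.isUnit_iff_isUnit_det T).1 hT
  have hWdet : IsUnit (1 + C₂ * V).det := (Matrix.isUnit_iff_isUnit_det _).1 h₂
  -- `T + V = T (1 + T⁻¹ V)` and `1 + T⁻¹ V = (1 + C₁ V W⁻¹) W`, `W = 1 + C₂ V`
  have h1 : T + V = T * (1 + T⁻¹ * V) := by
    rw [Matrix.mul_add, Matrix.mul_one, ← Matrix.mul_assoc, Matrix.mul_nonsing_inv T hTdet,
      Matrix.one_mul]
  have h2 : 1 + T⁻¹ * V = (1 + C₁ * V * (1 + C₂ * V)⁻¹) * (1 + C₂ * V) := by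
    rw [Matrix.add_mul, Matrix.one_mul, Matrix.mul_assoc (C₁ * V), Matrix.nonsing_inv_mul _ hWdet,
      Matrix.mul_one, hC, Matrix.add_mul]
    abel
  rw [h1, h2, Matrix.det_mul, Matrix.det_mul]
  ring

/-! ### The tangent inequality of `log det` -/

omit [DecidableEq n] in
/-- `Σ_i log ν_i ≤ Σ_i ν_i - |n|` for positive reals (`log x ≤ x - 1`). [folklore] -/
theorem sum_log_le_sum_sub_card (ν : n → ℝ) (hν : ∀ i, 0 < ν i) :
    ∑ i, Real.log (ν i) ≤ ∑ i, ν i - Fintype.card n := by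
  have : ∑ i, Real.log (ν i) ≤ ∑ i, (ν i - 1) :=
    Finset.sum_le_sum fun i _ => Real.log_le_sub_one_of_pos (hν i)
  simpa [Finset.sum_sub_distrib] using this

/-- For a positive definite complex matrix, `log (det P).re = Σ_i log λ_i(P)` and
`(Tr P).re = Σ_i λ_i(P)`, whence `log (det P).re ≤ (Tr P).re - |n|`. [folklore] -/
theorem log_re_det_le_re_trace_sub_card {P : Matrix n n ℂ} (hP : P.PosDef) :
    Real.log P.det.re ≤ P.trace.re - Fintype.card n := by
  have hdet : P.det = ((∏ i, hP.1.eigenvalues i : ℝ) : ℂ) := by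
    rw [hP.1.det_eq_prod_eigenvalues]
    push_cast
    rfl
  have htr : P.trace = ((∑ i, hP.1.eigenvalues i : ℝ) : ℂ) := by
    rw [hP.1.trace_eq_sum_eigenvalues]
    push_cast
    rfl
  rw [hdet, htr, Complex.ofReal_re, Complex.ofReal_re,
    Real.log_prod (s := Finset.univ) (fun i _ => (hP.eigenvalues_pos i).ne')]
  exact sum_log_le_sum_sub_card _ hP.eigenvalues_pos

/-- **Tangent inequality of `log det`** (concavity of `log det` on the positive definite cone):
`log det M ≤ log det M₀ + Tr(M₀⁻¹ (M - M₀))` for positive definite `M, M₀` (first lemma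
`log_det_le_tangent` of the crux idea `feshbach-shell-logdet`; Bhatia, *Matrix Analysis*, §V). [cite: Bhatia1997, §V] -/
theorem log_det_le_tangent (M M₀ : Matrix n n ℂ) (hM : M.PosDef) (hM₀ : M₀.PosDef) :
    Real.log M.det.re ≤ Real.log M₀.det.re + ((M₀⁻¹ * (M - M₀)).trace).re := by
  -- `R = (M₀⁻¹)^{1/2}`, `P = R M R`
  have hinv : M₀⁻¹.PosDef := hM₀.inv
  have hR0 : (0 : Matrix n n ℂ) ≤ M₀⁻¹ := hinv.posSemidef.nonneg
  set R : Matrix n n ℂ := CFC.sqrt M₀⁻¹ with hRdef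
  have hRR : R * R = M₀⁻¹ := CFC.sqrt_mul_sqrt_self M₀⁻¹ hR0
  have hRsa : R.IsHermitian := (CFC.sqrt_nonneg M₀⁻¹).isSelfAdjoint
  have hM₀det : IsUnit M₀.det := (Matrix.isUnit_iff_isUnit_det M₀).1 hM₀.isUnit
  have hdetinv : M₀⁻¹.det = M₀.det⁻¹ := by
    rw [Matrix.det_nonsing_inv, Ring.inverse_eq_inv]
  have hRdet : IsUnit R.det := by
    have h : R.det * R.det = M₀⁻¹.det := by rw [← Matrix.det_mul, hRR]
    have hne : M₀⁻¹.det ≠ 0 := by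
      rw [hdetinv]
      exact inv_ne_zero hM₀det.ne_zero
    rw [← h] at hne
    exact isUnit_iff_ne_zero.2 (left_ne_zero_of_mul hne)
  have hRunit : IsUnit R := (Matrix.isUnit_iff_isUnit_det R).2 hRdet
  set P : Matrix n n ℂ := R * M * R with hPdef
  have hP : P.PosDef := by
    have := hM.conjTranspose_mul_mul_same (B := R) (Matrix.mulVec_injective_of_isUnit hRunit)
    rwa [hRsa.eq] at this
  -- `det P = det M / det M₀`, `Tr P = Tr (M₀⁻¹ M)`
  have hdetP : P.det = M.det * M₀.det⁻¹ := by
    rw [hPdef, Matrix.det_mul, Matrix.det_mul, ← hdetinv,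
      show R.det * M.det * R.det = M.det * (R.det * R.det) by ring, ← Matrix.det_mul, hRR]
  have htrP : P.trace = (M₀⁻¹ * M).trace := by
    rw [hPdef, Matrix.trace_mul_cycle, hRR]
  -- real parts of the determinants
  have hdM : M.det = ((M.det.re : ℝ) : ℂ) := by
    obtain ⟨h1, h2⟩ := Complex.pos_iff.1 hM.det_pos
    exact Complex.ext (by simp) (by simp [← h2])
  have hdM₀ : M₀.det = ((M₀.det.re : ℝ) : ℂ) := by
    obtain ⟨h1, h2⟩ := Complex.pos_iff.1 hM₀.det_pos
    exact Complex.ext (by simp) (by simp [← h2])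
  have hMpos : 0 < M.det.re := (Complex.pos_iff.1 hM.det_pos).1
  have hM₀pos : 0 < M₀.det.re := (Complex.pos_iff.1 hM₀.det_pos).1
  have hdetPre : P.det.re = M.det.re / M₀.det.re := by
    rw [hdetP, hdM, hdM₀, ← Complex.ofReal_inv, ← Complex.ofReal_mul, Complex.ofReal_re,
      Complex.ofReal_re, Complex.ofReal_re, div_eq_mul_inv]
  have key := log_re_det_le_re_trace_sub_card hP
  rw [hdetPre, Real.log_div hMpos.ne' hM₀pos.ne', htrP] at key
  -- `Tr (M₀⁻¹ (M - M₀)) = Tr (M₀⁻¹ M) - |n|`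
  have htr : ((M₀⁻¹ * (M - M₀)).trace).re = ((M₀⁻¹ * M).trace).re - Fintype.card n := by
    rw [Matrix.mul_sub, Matrix.trace_sub, Matrix.nonsing_inv_mul M₀ hM₀det, Matrix.trace_one,
      Complex.sub_re]
    simp
  rw [htr]
  linarith

end Summit.HubbardSuperconductivity.HubbardSuperconductivity.Theorems

end
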